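import Summits.RiemannHypothesis.RiemannHypothesis.Theorems.MotivicDoorFfSparseWalk

/-!
# Motivic door, function-field side (C)(i), part 7c: SPARSE LAG SETS — residue classes of lags above the handover
(pub-rhdoor seat ff-1.  HONEST FRAMING: lottery ticket at the motivic door; RH probability negligible; consolation
prizes are real: a new semi-local Weil-positivity theorem, or a located gap in the Connes–Consani programme, plus the
ff-door theorem.  No claim about `ζ`; "RH(q,h)" is `|α| = √q` for the complex roots of ONE integer polynomial `h`.)

Parts 7a–7b settled the lag sets inside `[0, g]` (only the full set `{1, …, g}` decides RH at dimension `g`).  Above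
the handover POSITION matters through DIVISIBILITY: the roots of `x^k - c` have vanishing power sums at every
exponent `k ∤ n`, so honest data assembled from such pieces are invisible to all traces `K(n)`, `k ∤ n` — and they
come in both RH-types.  `F`-trace-local readers (`F : Set ℕ`, possibly infinite; inline `hloc`) as in part 7b.
PROVED here, [folklore]:

* §6 PIECES: `s_n(roots of x^k - c) = 0` for `k ∤ n` (`powerSum_nthRoots_eq_zero`, primitive `k`-th roots of unity
  and the geometric sum); the RH-true piece `x^{2k} + q^k` (`powerSum_X_pow_add_C_eq_zero`) and the RH-false piece
  `(x^k - 1)(x^k - q^k)` (`rhFalsePiece_spec`: honest of dimension `k`, vanishing at `1`); FE IS MULTIPLICATIVE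
  (`fe_mul`, through part 4's dictionary FE ⟺ roots-reciprocity ∧ `c_0 = q^g`).  Hence (`q ≥ 2`, `1 ≤ N ≤ g`,
  `N ∣ 2g`) the honest data `h⁺ = x^{2g} + q^g` (RH-true) and `h⁻ = (x^N - 1)(x^N - q^N)(x^{2(g-N)} + q^{g-N})`
  (RH-false; `(x^g - 1)(x^g - q^g)` when `N = g`) of dimension `g` have ALL power sums `s_n`, `N ∤ n`, equal to `0`
  (`exists_honest_pair_vanishing_offMultiples`).
* §7 DOOR: a trace reader reading no non-zero multiple of `N` — however many lags, wherever placed — takes the same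
  value on `h⁺` and `h⁻` (`traceReader_offMultiples_undecided`) and so cannot decide RH at dimension `g`
  (`traceReader_offMultiples_not_decides`); A DECIDING LAG SET CONTAINS A NON-ZERO MULTIPLE OF EVERY `N ∈ [1, g]`
  DIVIDING `2g` (`decidingLags_contain_multiples`); THE ODD HALF OF THE TOWER IS BLIND at every dimension `g ≥ 2`
  (`oddLags_not_decides`: `x^{2g} + q^g` versus `(x^2 - 1)(x^2 - q^2)(x^{2g-4} + q^{g-2})`).

DOOR READING ((i).G, final form with parts 6, 7a, 7b).  At dimension `g`: inside the first `g` lags only `{1, …, g}`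
certifies RH (7b); in general a certifying lag set must meet every residue tower `N ℕ ∖ {0}`, `N ≤ g`, `N ∣ 2g` (7c),
while the `2g` lags `0, N, …, (2g-1)N` of ONE arithmetic progression always suffice (part 6, Weil criterion after base
change).  NOT CLAIMED (DATA-level remarks, not formalised): the weighted count bound "`#F + ⌊max F/2⌋ < g` ⇒ blind",
the information-theoretic stride threshold `{N, …, gN}`, and single large lags `F = {n}`, `n ≥ 2g - 2`, whose
(in)decision is a `q`-dependent diophantine question.  Nothing here is, or implies, a statement about `ζ`.
-/

set_option linter.dupNamespace false

noncomputable section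

open Polynomial Finset

open Summit.RiemannHypothesis.RiemannHypothesis.Theorems.PfPersistence.FfAngleTwin

namespace Summit.RiemannHypothesis.RiemannHypothesis.Theorems.MotivicDoor.FunctionField

/-! ## 6. Residue classes of lags: data whose power sums vanish off the multiples of `N`

Above the handover, POSITION matters through divisibility: the roots of `x^k - c` have vanishing power sums at
every exponent not divisible by `k`, so honest data assembled from such pieces are invisible to all traces `K(n)`,
`k ∤ n` — and they come in both RH-types. -/

/-- Power sums are additive in the root multiset. [folklore] -/
theorem powerSum_add (A B : Multiset ℂ) (n : ℕ) : powerSum (A + B) n = powerSum A n + powerSum B n := by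
  simp [powerSum, Multiset.map_add, Multiset.sum_add]

/-- The roots of `x^k - c` (`k ≥ 1`; with multiplicity, any `c`) have power sum `0` at every exponent `n` with
`k ∤ n`: they are `μ ζ^i`, `i < k`, for a primitive `k`-th root of unity `ζ` and `μ^k = c`, and `Σ_i ζ^{n i} = 0`.
[folklore] -/
theorem powerSum_nthRoots_eq_zero {k : ℕ} (hk : 0 < k) (c : ℂ) {n : ℕ} (hn : ¬ k ∣ n) :
    powerSum (Polynomial.nthRoots k c) n = 0 := by
  obtain ⟨μ, hμ⟩ := IsAlgClosed.exists_pow_nat_eq c hk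
  have hζ := Complex.isPrimitiveRoot_exp k hk.ne'
  set ζ := Complex.exp (2 * Real.pi * Complex.I / k) with hζdef
  have hζn : ζ ^ n ≠ 1 := fun e => hn ((hζ.pow_eq_one_iff_dvd n).1 e)
  rw [powerSum, hζ.nthRoots_eq hμ, Multiset.map_map]
  calc ((Multiset.range k).map ((fun α : ℂ => α ^ n) ∘ fun i => ζ ^ i * μ)).sum
      = ∑ i ∈ Finset.range k, (ζ ^ i * μ) ^ n := by rw [Finset.sum_eq_multiset_sum, Finset.range_val]; rfl
    _ = μ ^ n * ∑ i ∈ Finset.range k, (ζ ^ n) ^ i := by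
        rw [Finset.mul_sum]
        exact sum_congr rfl fun i _ => by ring
    _ = 0 := by
        rw [geom_sum_eq hζn, ← pow_mul, mul_comm n k, pow_mul, hζ.pow_eq_one, one_pow, sub_self, zero_div,
          mul_zero]

/-- The roots of the integer polynomial `x^k + c` are the `k`-th roots of `-c`. [folklore] -/
theorem frobRoots_X_pow_add_C (k : ℕ) (c : ℤ) :
    frobRoots (X ^ k + C c : ℤ[X]) = Polynomial.nthRoots k (-(c : ℂ)) := by
  rw [frobRoots, Polynomial.nthRoots, Polynomial.map_add, Polynomial.map_pow, map_X, map_C, eq_intCast, map_neg,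
    sub_neg_eq_add]

/-- THE RH-TRUE PIECE `x^{2k} + q^k` (`k ≥ 1`): its power sums vanish at every exponent not divisible by `2k`.
[folklore] -/
theorem powerSum_X_pow_add_C_eq_zero (q : ℕ) {k : ℕ} (hk : 1 ≤ k) {n : ℕ} (hn : ¬ 2 * k ∣ n) :
    powerSum (frobRoots (X ^ (2 * k) + C ((q : ℤ) ^ k) : ℤ[X])) n = 0 := by
  rw [frobRoots_X_pow_add_C]
  exact powerSum_nthRoots_eq_zero (by omega) _ hn

/-- THE RH-FALSE PIECE `(x^k - 1)(x^k - q^k) = x^{2k} - (1 + q^k) x^k + q^k` (`k ≥ 1`): monic of degree `2k`,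
honest of dimension `k`, vanishing at `1`, with power sums `0` at every exponent not divisible by `k`. [folklore] -/
theorem rhFalsePiece_spec (q : ℕ) {k : ℕ} (hk : 1 ≤ k) :
    ((X ^ k - C 1) * (X ^ k - C ((q : ℤ) ^ k)) : ℤ[X]).Monic ∧
    ((X ^ k - C 1) * (X ^ k - C ((q : ℤ) ^ k)) : ℤ[X]).natDegree = 2 * k ∧
    (∀ i j, i + j = 2 * k →
      (q : ℤ) ^ k * ((X ^ k - C 1) * (X ^ k - C ((q : ℤ) ^ k)) : ℤ[X]).coeff j
        = (q : ℤ) ^ i * ((X ^ k - C 1) * (X ^ k - C ((q : ℤ) ^ k)) : ℤ[X]).coeff i) ∧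
    ((X ^ k - C 1) * (X ^ k - C ((q : ℤ) ^ k)) : ℤ[X]).eval 1 = 0 ∧
    ∀ n, ¬ k ∣ n → powerSum (frobRoots ((X ^ k - C 1) * (X ^ k - C ((q : ℤ) ^ k)) : ℤ[X])) n = 0 := by
  have hk0 : k ≠ 0 := by omega
  have hm1 : (X ^ k - C (1 : ℤ)).Monic := monic_X_pow_sub_C _ hk0
  have hm2 : (X ^ k - C ((q : ℤ) ^ k)).Monic := monic_X_pow_sub_C _ hk0
  have hmon := hm1.mul hm2
  have hdeg : ((X ^ k - C 1) * (X ^ k - C ((q : ℤ) ^ k)) : ℤ[X]).natDegree = 2 * k := by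
    rw [hm1.natDegree_mul hm2, natDegree_X_pow_sub_C, natDegree_X_pow_sub_C]; ring
  have hexp : ((X ^ k - C 1) * (X ^ k - C ((q : ℤ) ^ k)) : ℤ[X])
      = X ^ (2 * k) + C (-(1 + (q : ℤ) ^ k)) * X ^ k + C ((q : ℤ) ^ k) := by
    simp only [map_neg, map_add, map_one, map_pow, C_eq_natCast]
    ring
  refine ⟨hmon, hdeg, ?_, by simp [eval_mul], fun n hn => ?_⟩
  · intro i j hij
    rw [hexp]
    simp only [coeff_add, coeff_X_pow, coeff_C_mul_X_pow, coeff_C]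
    by_cases hj2 : j = 2 * k
    · have hi0 : i = 0 := by omega
      rw [if_pos hj2, if_neg (by omega : j ≠ k), if_neg (by omega : j ≠ 0), if_neg (by omega : i ≠ 2 * k),
        if_neg (by omega : i ≠ k), if_pos hi0, hi0]
      ring
    · by_cases hjk : j = k
      · have hik : i = k := by omega
        rw [hjk, hik]
      · by_cases hj0 : j = 0
        · have hi : i = 2 * k := by omega
          rw [if_neg hj2, if_neg hjk, if_pos hj0, if_pos hi, if_neg (by omega : i ≠ k), if_neg (by omega : i ≠ 0),
            hi]
          ring
        · rw [if_neg hj2, if_neg hjk, if_neg hj0, if_neg (by omega : i ≠ 2 * k), if_neg (by omega : i ≠ k),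
            if_neg (by omega : i ≠ 0)]
          ring
  · have hne : ((X ^ k - C (1 : ℤ)) * (X ^ k - C ((q : ℤ) ^ k))).map (Int.castRingHom ℂ) ≠ 0 :=
      (hmon.map _).ne_zero
    rw [frobRoots, Polynomial.map_mul] at *
    rw [roots_mul hne, powerSum_add]
    have e1 : (X ^ k - C (1 : ℤ)).map (Int.castRingHom ℂ) = X ^ k - C 1 := by
      rw [Polynomial.map_sub, Polynomial.map_pow, map_X, map_C, map_one]
    have e2 : (X ^ k - C ((q : ℤ) ^ k)).map (Int.castRingHom ℂ) = X ^ k - C ((q : ℂ) ^ k) := by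
      rw [Polynomial.map_sub, Polynomial.map_pow, map_X, map_C, map_pow, eq_intCast]; push_cast; rfl
    rw [e1, e2, ← Polynomial.nthRoots, ← Polynomial.nthRoots, powerSum_nthRoots_eq_zero (by omega) _ hn,
      powerSum_nthRoots_eq_zero (by omega) _ hn, zero_add]

/-- FE is MULTIPLICATIVE: the product of honest data of dimensions `g₁, g₂` is honest of dimension `g₁ + g₂`
(`q ≥ 1`; roots-reciprocity and `c_0 = q^g`, part 4's dictionary). [folklore] -/
theorem fe_mul {q : ℕ} (hq : 0 < q) {g₁ g₂ : ℕ} {f₁ f₂ : ℤ[X]} (h₁ : f₁.Monic) (h₂ : f₂.Monic)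
    (hd₁ : f₁.natDegree = 2 * g₁) (hd₂ : f₂.natDegree = 2 * g₂)
    (hFE₁ : ∀ i j, i + j = 2 * g₁ → (q : ℤ) ^ g₁ * f₁.coeff j = (q : ℤ) ^ i * f₁.coeff i)
    (hFE₂ : ∀ i j, i + j = 2 * g₂ → (q : ℤ) ^ g₂ * f₂.coeff j = (q : ℤ) ^ i * f₂.coeff i) :
    ∀ i j, i + j = 2 * (g₁ + g₂) →
      (q : ℤ) ^ (g₁ + g₂) * (f₁ * f₂).coeff j = (q : ℤ) ^ i * (f₁ * f₂).coeff i := by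
  have hmon := h₁.mul h₂
  have hdeg : (f₁ * f₂).natDegree = 2 * (g₁ + g₂) := by rw [h₁.natDegree_mul h₂, hd₁, hd₂]; ring
  obtain ⟨hr₁, hc₁⟩ := (fe_iff_map_reciprocal_and_coeff_zero hq h₁ hd₁).1 hFE₁
  obtain ⟨hr₂, hc₂⟩ := (fe_iff_map_reciprocal_and_coeff_zero hq h₂ hd₂).1 hFE₂
  refine (fe_iff_map_reciprocal_and_coeff_zero hq hmon hdeg).2 ⟨?_, ?_⟩
  · have hroots : frobRoots (f₁ * f₂) = frobRoots f₁ + frobRoots f₂ := by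
      rw [frobRoots, Polynomial.map_mul, roots_mul ((h₁.map _).mul (h₂.map _)).ne_zero]; rfl
    rw [hroots, Multiset.map_add, hr₁, hr₂]
  · rw [mul_coeff_zero, hc₁, hc₂, pow_add]

/-- RESIDUE-CLASS WITNESSES: for `q ≥ 2`, `1 ≤ N ≤ g` and `N ∣ 2g` there are honest data `h⁺` (RH-true:
`x^{2g} + q^g`) and `h⁻` (RH-false: `(x^N - 1)(x^N - q^N)(x^{2(g-N)} + q^{g-N})`, resp. `(x^g - 1)(x^g - q^g)` for
`N = g`) of dimension `g` ALL of whose power sums `s_n`, `N ∤ n`, vanish. [folklore] -/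
theorem exists_honest_pair_vanishing_offMultiples {q : ℕ} (hq : 2 ≤ q) {g N : ℕ} (hN1 : 1 ≤ N) (hNg : N ≤ g)
    (hN : N ∣ 2 * g) :
    ∃ hp hm : ℤ[X],
      (hp.Monic ∧ hp.natDegree = 2 * g ∧
        ∀ i j, i + j = 2 * g → (q : ℤ) ^ g * hp.coeff j = (q : ℤ) ^ i * hp.coeff i) ∧
      (hm.Monic ∧ hm.natDegree = 2 * g ∧
        ∀ i j, i + j = 2 * g → (q : ℤ) ^ g * hm.coeff j = (q : ℤ) ^ i * hm.coeff i) ∧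
      (∀ α ∈ frobRoots hp, ‖α‖ = Real.sqrt q) ∧ (¬ ∀ α ∈ frobRoots hm, ‖α‖ = Real.sqrt q) ∧
      ∀ n, ¬ N ∣ n → powerSum (frobRoots hp) n = 0 ∧ powerSum (frobRoots hm) n = 0 := by
  have hq0 : 0 < q := by omega
  have hg : 1 ≤ g := le_trans hN1 hNg
  -- `h⁺ = x^{2g} + q^g`
  have hplus := fe_X_pow_add_C q hg
  have hps_plus : ∀ n, ¬ N ∣ n → powerSum (frobRoots (X ^ (2 * g) + C ((q : ℤ) ^ g) : ℤ[X])) n = 0 :=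
    fun n hn => powerSum_X_pow_add_C_eq_zero q hg fun h2g => hn (hN.trans h2g)
  -- `h⁻`
  obtain ⟨hRm, hRd, hRFE, hR1, hRps⟩ := rhFalsePiece_spec q hN1
  rcases hNg.lt_or_eq with hlt | heq
  · -- `N < g`: pad with the RH-true piece `x^{2(g-N)} + q^{g-N}`
    have hgN : 1 ≤ g - N := by omega
    obtain ⟨hQm, hQd, hQFE⟩ := fe_X_pow_add_C q hgN
    have hFE := fe_mul hq0 hRm hQm hRd hQd hRFE hQFE
    rw [show N + (g - N) = g by omega] at hFE
    refine ⟨_, _, hplus, ⟨hRm.mul hQm, by rw [hRm.natDegree_mul hQm, hRd, hQd]; omega, hFE⟩,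
      ffRH_X_pow_add_C q hg, not_ffRH_of_eval_one hq (hRm.mul hQm) (by rw [eval_mul, hR1, zero_mul]),
      fun n hn => ⟨hps_plus n hn, ?_⟩⟩
    have hroots : frobRoots ((X ^ N - C 1) * (X ^ N - C ((q : ℤ) ^ N)) * (X ^ (2 * (g - N)) + C ((q : ℤ) ^ (g - N))))
        = frobRoots ((X ^ N - C 1) * (X ^ N - C ((q : ℤ) ^ N))) + frobRoots (X ^ (2 * (g - N)) + C ((q : ℤ) ^ (g - N))) := by
      rw [frobRoots, Polynomial.map_mul, roots_mul ((hRm.map _).mul (hQm.map _)).ne_zero]; rfl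
    rw [hroots, powerSum_add, hRps n hn, zero_add]
    refine powerSum_X_pow_add_C_eq_zero q hgN fun h2 => hn ?_
    -- `N ∣ 2(g - N)` since `N ∣ 2g`
    have hdvd : N ∣ 2 * (g - N) := by
      have e : 2 * (g - N) = 2 * g - 2 * N := by omega
      rw [e]; exact Nat.dvd_sub hN (dvd_mul_left N 2)
    exact hdvd.trans h2
  · -- `N = g`
    subst heq
    exact ⟨_, _, hplus, ⟨hRm, hRd, hRFE⟩, ffRH_X_pow_add_C q hg, not_ffRH_of_eval_one hq hRm hR1,
      fun n hn => ⟨hps_plus n hn, hRps n hn⟩⟩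

/-! ## 7. Door reading above the handover: lags off the multiples of `N` are jointly blind -/

/-- FF-DOOR (i).G, RESIDUE CLASSES: a trace reader that reads NO non-zero multiple of `N` (`1 ≤ N ≤ g`, `N ∣ 2g`,
`q ≥ 2`) — however many lags it reads, at whatever positions — takes the same value on an RH-true and on an RH-false
honest datum of dimension `g`; it cannot decide RH at dimension `g`.  `N = 2`: the ODD HALF OF THE TOWER is blind at
every dimension `g ≥ 2`; `N = g`: so is the set of all lags not divisible by `g`. [folklore] -/
theorem traceReader_offMultiples_undecided {Φ : Tower → Prop} {F : Set ℕ} {q : ℕ} (hq : 2 ≤ q) {g N : ℕ}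
    (hN1 : 1 ≤ N) (hNg : N ≤ g) (hN : N ∣ 2 * g) (hF : ∀ n ∈ F, N ∣ n → n = 0)
    (hloc : ∀ T T' : Tower, (∀ n ∈ F, T n 0 (Fin.last n) = T' n 0 (Fin.last n)) → Φ T → Φ T') :
    ∃ hp hm : ℤ[X],
      (hp.Monic ∧ hp.natDegree = 2 * g ∧
        ∀ i j, i + j = 2 * g → (q : ℤ) ^ g * hp.coeff j = (q : ℤ) ^ i * hp.coeff i) ∧
      (hm.Monic ∧ hm.natDegree = 2 * g ∧
        ∀ i j, i + j = 2 * g → (q : ℤ) ^ g * hm.coeff j = (q : ℤ) ^ i * hm.coeff i) ∧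
      (∀ α ∈ frobRoots hp, ‖α‖ = Real.sqrt q) ∧ (¬ ∀ α ∈ frobRoots hm, ‖α‖ = Real.sqrt q) ∧
      (Φ (weilWindowTower (q : ℝ) hp) ↔ Φ (weilWindowTower (q : ℝ) hm)) := by
  have hq' : (0 : ℝ) < q := by exact_mod_cast (show 0 < q by omega)
  obtain ⟨hp, hm, hhp, hhm, hRp, hRm, hps⟩ := exists_honest_pair_vanishing_offMultiples hq hN1 hNg hN
  have htr : ∀ n ∈ F, weilWindowTower (q : ℝ) hp n 0 (Fin.last n) = weilWindowTower (q : ℝ) hm n 0 (Fin.last n) := by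
    intro n hn
    by_cases hNn : N ∣ n
    · rw [hF n hn hNn]
      exact corner_zero_eq_of_natDegree_eq _ hhp.1 hhm.1 (hhp.2.1.trans hhm.2.1.symm)
    · exact (corner_eq_iff_powerSum_eq hq' hp hm n).2 (by rw [(hps n hNn).1, (hps n hNn).2])
  exact ⟨hp, hm, hhp, hhm, hRp, hRm, hloc _ _ htr, hloc _ _ fun n hn => (htr n hn).symm⟩

/-- … hence NO such reader decides RH at dimension `g`. [folklore] -/
theorem traceReader_offMultiples_not_decides {F : Set ℕ} {q : ℕ} (hq : 2 ≤ q) {g N : ℕ}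
    (hN1 : 1 ≤ N) (hNg : N ≤ g) (hN : N ∣ 2 * g) (hF : ∀ n ∈ F, N ∣ n → n = 0) :
    ¬ ∃ Φ : Tower → Prop,
      (∀ T T' : Tower, (∀ n ∈ F, T n 0 (Fin.last n) = T' n 0 (Fin.last n)) → Φ T → Φ T') ∧
      ∀ h : ℤ[X], h.Monic → h.natDegree = 2 * g →
        (∀ i j, i + j = 2 * g → (q : ℤ) ^ g * h.coeff j = (q : ℤ) ^ i * h.coeff i) →
        (Φ (weilWindowTower (q : ℝ) h) ↔ ∀ α ∈ frobRoots h, ‖α‖ = Real.sqrt q) := by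
  rintro ⟨Φ, hloc, hdec⟩
  obtain ⟨hp, hm, hhp, hhm, hRp, hRm, hiff⟩ := traceReader_offMultiples_undecided hq hN1 hNg hN hF hloc
  exact hRm ((hdec hm hhm.1 hhm.2.1 hhm.2.2).1 (hiff.1 ((hdec hp hhp.1 hhp.2.1 hhp.2.2).2 hRp)))

/-- FF-DOOR (i).G, NECESSARY CONDITION ON DECIDING LAG SETS: if some `F`-trace-local reader decides RH on the honest
data of dimension `g` (`q ≥ 2`), then `F` contains a NON-ZERO MULTIPLE OF EVERY `N ∈ [1, g]` DIVIDING `2g` — an even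
lag (g ≥ 2), a multiple of `g`, a multiple of every divisor of `g`, … [folklore] -/
theorem decidingLags_contain_multiples {F : Set ℕ} {q : ℕ} (hq : 2 ≤ q) {g : ℕ}
    (hdec : ∃ Φ : Tower → Prop,
      (∀ T T' : Tower, (∀ n ∈ F, T n 0 (Fin.last n) = T' n 0 (Fin.last n)) → Φ T → Φ T') ∧
      ∀ h : ℤ[X], h.Monic → h.natDegree = 2 * g →
        (∀ i j, i + j = 2 * g → (q : ℤ) ^ g * h.coeff j = (q : ℤ) ^ i * h.coeff i) →
        (Φ (weilWindowTower (q : ℝ) h) ↔ ∀ α ∈ frobRoots h, ‖α‖ = Real.sqrt q))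
    {N : ℕ} (hN1 : 1 ≤ N) (hNg : N ≤ g) (hN : N ∣ 2 * g) : ∃ n ∈ F, n ≠ 0 ∧ N ∣ n := by
  by_contra hno
  push Not at hno
  exact traceReader_offMultiples_not_decides hq hN1 hNg hN (fun n hn hNn => by
    by_contra h0; exact hno n hn h0 hNn) hdec

/-- THE ODD HALF OF THE TOWER IS BLIND: a reader of odd lags only (and lag `0`) never decides RH at any dimension
`g ≥ 2` (`q ≥ 2`) — the data `x^{2g} + q^g` (RH-true) and `(x^2 - 1)(x^2 - q^2)(x^{2g-4} + q^{g-2})` (RH-false) are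
EVEN polynomials with the same (vanishing) odd traces. [folklore] -/
theorem oddLags_not_decides {F : Set ℕ} {q : ℕ} (hq : 2 ≤ q) {g : ℕ} (hg : 2 ≤ g)
    (hF : ∀ n ∈ F, n = 0 ∨ Odd n) :
    ¬ ∃ Φ : Tower → Prop,
      (∀ T T' : Tower, (∀ n ∈ F, T n 0 (Fin.last n) = T' n 0 (Fin.last n)) → Φ T → Φ T') ∧
      ∀ h : ℤ[X], h.Monic → h.natDegree = 2 * g →
        (∀ i j, i + j = 2 * g → (q : ℤ) ^ g * h.coeff j = (q : ℤ) ^ i * h.coeff i) →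
        (Φ (weilWindowTower (q : ℝ) h) ↔ ∀ α ∈ frobRoots h, ‖α‖ = Real.sqrt q) :=
  traceReader_offMultiples_not_decides hq (N := 2) (by omega) hg (dvd_mul_right 2 g) fun n hn h2 => by
    rcases hF n hn with h0 | hodd
    · exact h0
    · exact absurd h2 (Nat.not_even_iff_odd.2 hodd ∘ even_iff_two_dvd.2)

end Summit.RiemannHypothesis.RiemannHypothesis.Theorems.MotivicDoor.FunctionField

end
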